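import Literature.Analysis.FluidPDE.PassiveScalarSpectralBounds
import Literature.Analysis.FluidPDE.PassiveScalarForcedClass
import HarnessLib

/-!
# Measurability of the spectral gradient norm along a sourced weak passive scalar

Analysis/FluidPDE proof-support file (everything proved). The sourced-class
(`Torus.IsWeakScalarTransportForcedOn`) counterparts of two facts of `PassiveScalarSpectralBounds`:
each Fourier coefficient `t ↦ 𝓕(θ(t))(k)` is a.e.-strongly measurable on `(0,T)`, hence
`t ↦ eScalarGradNormSq (θ t) = 4π² ∑ₖ |k|² |θ̂(t)(k)|²` is a.e.-measurable (needed to integrate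
the dissipation rate of a steadily sourced scalar in time). [folklore]
-/

noncomputable section

open MeasureTheory TopologicalSpace Set Function Filter Topology UnitAddTorus
open scoped ENNReal

namespace Literature.Analysis.FluidPDE

namespace Torus

variable {d : Type*} [Fintype d]

namespace IsWeakScalarTransportForcedOn

variable {T κ : ℝ} {u : ℝ → UnitAddTorus d → EuclideanSpace ℝ d} {s : ℝ → UnitAddTorus d → ℝ}
  {θ₀ : UnitAddTorus d → ℝ} {θ : ℝ → UnitAddTorus d → ℝ}

/-- Each Fourier coefficient `t ↦ 𝓕(θ(t))(k)` of a sourced weak solution is a.e.-strongly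
measurable on `(0,T)`. [folklore] -/
theorem aestronglyMeasurable_mFourierCoeff (h : IsWeakScalarTransportForcedOn T κ u s θ₀ θ) (k : d → ℤ) :
    AEStronglyMeasurable (fun t => mFourierCoeff (fun x => (θ t x : ℂ)) k)
      ((volume : Measure ℝ).restrict (Ioo 0 T)) := by
  have e : (fun t => mFourierCoeff (fun x => (θ t x : ℂ)) k) = fun t => ∫ x, mFourier (-k) x • (θ t x : ℂ) := by
    funext t
    exact FunctionSpaces.Torus.mFourierCoeff_eq_integral_volume _ k
  rw [e]
  have hm : AEStronglyMeasurable (uncurry fun t x => mFourier (-k) x • (θ t x : ℂ))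
      (((volume : Measure ℝ).restrict (Ioo 0 T)).prod volume) :=
    ((mFourier (-k)).continuous.comp continuous_snd).aestronglyMeasurable.smul
      (Complex.continuous_ofReal.comp_aestronglyMeasurable h.aestronglyMeasurable_uncurry)
  exact hm.integral_prod_right'

/-- `t ↦ eScalarGradNormSq (θ t)` is a.e.-measurable on `(0,T)` for a sourced weak solution.
[folklore] -/
theorem aemeasurable_eScalarGradNormSq (h : IsWeakScalarTransportForcedOn T κ u s θ₀ θ) :
    AEMeasurable (fun t => eScalarGradNormSq (θ t)) ((volume : Measure ℝ).restrict (Ioo 0 T)) := by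
  have e : (fun t => eScalarGradNormSq (θ t)) = fun t => ENNReal.ofReal (4 * Real.pi ^ 2) *
      ∑' k : d → ℤ, ENNReal.ofReal (FunctionSpaces.Torus.freqNormSq k) * ‖mFourierCoeff (fun x => (θ t x : ℂ)) k‖ₑ ^ 2 := by
    funext t
    exact eScalarGradNormSq_eq_tsum (θ t)
  rw [e]
  refine AEMeasurable.const_mul (AEMeasurable.tsum fun k => ?_) _
  exact ((h.aestronglyMeasurable_mFourierCoeff k).enorm.pow_const 2).const_mul _

end IsWeakScalarTransportForcedOn

end Torus

end Literature.Analysis.FluidPDE
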